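import Mathlib
import Literature.Analysis.FluidPDE.Tao2016AveragedNS.BoundedEternalSolutions
import Summits.NavierStokesRegularity.NavierStokesRegularity.Theorems.WakeRatchetTailRatchetDSSVisc
import HarnessLib

/-!
# `WakeRatchet.TailRatchet` (stmt-NavierStokesRegularity-21808): the VISCOUS DSS door in ONE-PROFILE
# form — a single viscous travelling-wave profile is a uniformly bounded admissible block-DSS eternal
# solution; kill criterion stated on the profile

The tree's kill criterion `WakeRatchetDSS.tailRatchet_false_of_persistent_blockDSS_visc` asks, at
arbitrarily small `ε₀` on one table of a fixed `E₂(R)`, for a uniformly bounded admissible viscous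
eternal solution `W` (`IsEternalVisc ε₀ ν̂ α W`, `UniformBound W`) that is block-self-similar,
`W_{n+p}(σ) = W_n(σ − T)`.  For period `p = 1` such a solution IS one profile: `W_n(σ) = Φ(σ − nT)`,
and the covariant viscosity `ν̂ (1+ε₀)^{2n} e^{−σ}` is compatible with the ansatz exactly when the
delay is PINNED to `T = 2 log(1+ε₀)` (per-shell energy ratio `e^{2T}Λ^{-2} = (1+ε₀)^{-1}`, the
NS-critical `a = 1` balance — the delay of the tree's proved `PerpetualPump.CircuitPump`, whose DSS
symmetry is `X_{n+1}(λ^{-4/5}t) = λ^{-1/5}X_n(t)`, `λ = Λ`).  This file proves the dictionary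

  `eternalVisc_of_viscousProfile`: a profile `Φ : ℝ → ℝ⁴` solving the pinned viscous profile equation
  `Φ'(σ) = −Φ + Q(Φ) + Λ A(Φ(σ+T)) + Λ⁻¹ B(Φ(σ−T), Φ) − ν̂ e^{−σ} Φ`, `T = 2 log(1+ε₀)`, with
  `∫‖Φ‖ < ∞`, `e^{2σ}‖Φ(σ)‖²` bounded forward and `‖Φ‖` bounded, carries the admissible uniformly
  bounded block-DSS (period 1) eternal solution `W_n(σ) = Φ(σ − nT)`;

so that ALL admissibility clauses become ONE-SHELL conditions, and restates the kill criterion on the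
profile (`TailRatchet_false_of_viscousProfiles`).  This is the exact target a fixed-seed version of
`CircuitPump` (see `…SeededTodaClass` / `…SeededTodaWaves`) would have to hit, shell `0` only.

HONEST FRAMING: MODEL lattice ODEs only (Tao 2016 §4, the viscous equation before Thm. 4.2);
nothing here concerns the Navier–Stokes equations; stmt-21808 is neither proved nor refuted here.
-/

noncomputable section

set_option linter.dupNamespace false

namespace Summit.NavierStokesRegularity.NavierStokesRegularity.Theorems

namespace WakeRatchetViscousProfile

open MeasureTheory Set Filter Topology
open Literature.Analysis.FluidPDE Literature.Analysis.FluidPDE.TaoCascade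

variable {m : ℕ}

/-- The pinned delay makes the covariant viscosity shell-periodic:
`(1+ε₀)^{2n} e^{−σ} = e^{−(σ − nT)}` for `T = 2 log(1+ε₀)`.
[cite: Tao2016AveragedNS, §4, the viscous equation before Thm. 4.2; cell theorem] -/
theorem viscCoef_shift {ε₀ T : ℝ} (hε : 0 < ε₀) (hT : T = 2 * Real.log (1 + ε₀)) (n : ℤ) (σ : ℝ) :
    (1 + ε₀) ^ ((2 : ℝ) * n) * Real.exp (-σ) = Real.exp (-(σ - n * T)) := by
  have h1 : (0 : ℝ) < 1 + ε₀ := by linarith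
  rw [Real.rpow_def_of_pos h1, ← Real.exp_add, hT]
  congr 1
  ring

/-- **One viscous profile ⟹ admissible uniformly bounded block-DSS eternal solution.**  If
`Φ : ℝ → ℝ^m` solves the pinned viscous profile equation (delay `T = 2 log(1+ε₀)`, covariant
viscosity `ν̂ e^{−σ}` at shell `0`), is integrable in norm, has `e^{2σ}‖Φ(σ)‖²` bounded forward and
`‖Φ‖` bounded, then `W_n(σ) := Φ(σ − nT)` satisfies `IsEternalVisc ε₀ ν̂ α W`, `UniformBound W` and
`W_{n+1}(σ) = W_n(σ − T)`.
[cite: Tao2016AveragedNS, §4 Lemma 4.1 (iii) (4.8) and the viscous equation before Thm. 4.2, in the self-similar variables of §6.4; cell theorem] -/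
theorem eternalVisc_of_viscousProfile {ε₀ νh T : ℝ} {α : Fin m → Fin m → Fin m → ℤ × ℤ × ℤ → ℝ}
    {Φ : ℝ → Em m} {W : ℤ → ℝ → Em m} (hε : 0 < ε₀) (hν : 0 ≤ νh) (hT : T = 2 * Real.log (1 + ε₀))
    (hlaw : ∀ σ, HasDerivAt Φ
      (-((1 : ℝ) • Φ σ) + tableQ α (Φ σ) + bigLam ε₀ • tableA α (Φ (σ + T))
        + (bigLam ε₀)⁻¹ • tableB α (Φ (σ - T)) (Φ σ) - (νh * Real.exp (-σ)) • Φ σ) σ)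
    (hint : Integrable (fun σ => ‖Φ σ‖))
    (hbdd : ∃ σ₀ P : ℝ, ∀ σ, σ₀ ≤ σ → Real.exp (2 * σ) * ‖Φ σ‖ ^ 2 ≤ P)
    (hsup : ∃ C : ℝ, ∀ σ, ‖Φ σ‖ ≤ C)
    (hW : ∀ (n : ℤ) (σ : ℝ), W n σ = Φ (σ - n * T)) :
    IsEternalVisc ε₀ νh α W ∧ UniformBound W ∧ ∀ (n : ℤ) (σ : ℝ), W (n + 1) σ = W n (σ - T) := by
  have hfun : ∀ n : ℤ, W n = fun σ => Φ (σ - n * T) := fun n => funext (hW n)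
  refine ⟨⟨fun n σ => ?_, hν, ?_, fun n => ?_⟩, ?_, fun n σ => ?_⟩
  · -- the law at shell `n` is the profile equation at `σ - nT`
    have hin : HasDerivAt (fun s : ℝ => s - n * T) 1 σ := (hasDerivAt_id σ).sub_const _
    have hc := (hlaw (σ - n * T)).scomp σ hin
    rw [one_smul] at hc
    rw [hW (n - 1), hW (n + 1), hW n, hfun n]
    refine hc.congr_deriv ?_
    have e1 : σ - n * T + T = σ - (↑(n - 1) : ℝ) * T := by push_cast; ring
    have e2 : σ - n * T - T = σ - (↑(n + 1) : ℝ) * T := by push_cast; ring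
    rw [e1, e2, viscCoef_shift hε hT n σ]
  · -- uniform action
    refine ⟨∫ σ, ‖Φ σ‖, fun n => ?_⟩
    rw [hfun n]
    refine ⟨hint.comp_sub_right _, le_of_eq ?_⟩
    exact integral_sub_right_eq_self (fun σ => ‖Φ σ‖) _
  · -- forward bound at shell `n`
    obtain ⟨σ₀, P, hP⟩ := hbdd
    refine ⟨σ₀ + n * T, Real.exp (2 * (n * T)) * P, fun σ hσ => ?_⟩
    have h := hP (σ - n * T) (by linarith)
    have hexp : Real.exp (2 * σ) = Real.exp (2 * (n * T)) * Real.exp (2 * (σ - n * T)) := by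
      rw [← Real.exp_add]; ring_nf
    rw [hW n σ, hexp, mul_assoc]
    exact mul_le_mul_of_nonneg_left h (Real.exp_pos _).le
  · obtain ⟨C, hC⟩ := hsup
    exact ⟨C, fun n σ => by rw [hW n σ]; exact hC _⟩
  · rw [hW, hW]
    congr 1
    push_cast
    ring

/-- **Kill criterion on the profile.**  Pinned viscous profiles (any `ν̂ ≥ 0`), non-trivial, on tables
of one fixed class `E₂(R)` at arbitrarily small scale ratios refute `TailRatchet`
(`eternalVisc_of_viscousProfile` + `WakeRatchetDSS.tailRatchet_false_of_persistent_blockDSS_visc`).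
Negative lemma modulo that construction.
[cite: Tao2016AveragedNS, §4; cell theorem] -/
theorem TailRatchet_false_of_viscousProfiles {R : ℝ} (hR : 1 ≤ R)
    (hF : ∀ δ : ℝ, 0 < δ → ∃ ε₀ : ℝ, 0 < ε₀ ∧ ε₀ ≤ δ ∧
      ∃ α : Fin 4 → Fin 4 → Fin 4 → ℤ × ℤ × ℤ → ℝ, InTableClass R α ∧
        ∃ (νh : ℝ) (Φ : ℝ → Em 4), 0 ≤ νh ∧
          (∀ σ, HasDerivAt Φ
            (-((1 : ℝ) • Φ σ) + tableQ α (Φ σ)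
              + bigLam ε₀ • tableA α (Φ (σ + 2 * Real.log (1 + ε₀)))
              + (bigLam ε₀)⁻¹ • tableB α (Φ (σ - 2 * Real.log (1 + ε₀))) (Φ σ)
              - (νh * Real.exp (-σ)) • Φ σ) σ) ∧
          Integrable (fun σ => ‖Φ σ‖) ∧
          (∃ σ₀ P : ℝ, ∀ σ, σ₀ ≤ σ → Real.exp (2 * σ) * ‖Φ σ‖ ^ 2 ≤ P) ∧
          (∃ C : ℝ, ∀ σ, ‖Φ σ‖ ≤ C) ∧ ∃ σ, Φ σ ≠ 0) :
    ¬ Summit.NavierStokesRegularity.NavierStokesRegularity.Theses.WakeRatchet.TailRatchet := by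
  refine WakeRatchetDSS.tailRatchet_false_of_persistent_blockDSS_visc hR fun δ hδ => ?_
  obtain ⟨ε₀, hε₀, hle, α, hα, νh, Φ, hν, hlaw, hint, hbdd, hsup, σ₁, hne⟩ := hF δ hδ
  have hT : 0 < 2 * Real.log (1 + ε₀) := by
    have := Real.log_pos (by linarith : (1 : ℝ) < 1 + ε₀); linarith
  obtain ⟨hW, hU, hD⟩ := eternalVisc_of_viscousProfile (T := 2 * Real.log (1 + ε₀))
    (W := fun n σ => Φ (σ - n * (2 * Real.log (1 + ε₀)))) hε₀ hν rfl hlaw hint hbdd hsup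
    (fun _ _ => rfl)
  refine ⟨ε₀, hε₀, hle, α, hα, νh, _, 1, 2 * Real.log (1 + ε₀), hT, hW, hU, ?_, 0, σ₁, ?_⟩
  · intro n σ
    simpa using hD n σ
  · simpa using hne

end WakeRatchetViscousProfile

end Summit.NavierStokesRegularity.NavierStokesRegularity.Theorems

end
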